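import Mathlib.NumberTheory.Zsqrtd.GaussianInt
import Mathlib.NumberTheory.Real.Irrational
import Mathlib.LinearAlgebra.Matrix.Adjugate
import Mathlib.LinearAlgebra.Matrix.NonsingularInverse
import Literature.Barriers.Schanuel.EFunctionValuesAtAlgebraicPointsMinors
import Literature.Computability.QuantumComplexity.ReversibleCliffordT
import HarnessLib

/-!
# The ring `ℤ[ω]`, `ω = e^{iπ/4}`, as pairs of Gaussian integers; Cramer's rule with coordinate bounds

Topic `Literature/Computability/QuantumComplexity`; first support file for the discharge of the named
fact `MehrabanTahmasbi2024_PSharpP_subset_PPoly_of_stabilizerRank_poly` (`StabilizerRankPermanent.lean`,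
Mehraban–Tahmasbi 2024, Thm. 1.6: a polynomial exact stabilizer rank of `|T⟩^{⊗m}` puts `P^{#P}` in
`P/poly`). The printed proof (arXiv:2305.10277, p. 6) stores the coefficients `c₁, …, c_r` of a minimal
stabilizer decomposition `|T⟩^{⊗m} = Σ cᵢ φᵢ` as polynomial advice: "`β = G c` … `G` is invertible;
because `φ₁, …, φ_r` are linearly independent, otherwise the decomposition would not be minimal …
polynomial bits of precision are enough to store `G⁻¹` (Gaussian elimination)". We realise this step
EXACTLY rather than to finite precision: all amplitudes involved lie in the ring `ℤ[ω]`, `ω = e^{iπ/4}`,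
and Cramer's rule over `ℤ[ω]` produces a decomposition `D · b = Σ aᵢ uᵢ` with `D, aᵢ ∈ ℤ[ω]`, `D ≠ 0`,
whose integer coordinates are bounded by `r! · 4^r · B^r` (so of bit-length polynomial in `r` and
`log B`).

* `ZOmega` — the ring `ℤ[ω] = ℤ[i] ⊕ ℤ[i]·ω` (`ω² = i`) as pairs `(p, q)` of Gaussian integers, a
  `CommRing`; `ZOmega.val : ZOmega →+* ℂ`, `(p, q) ↦ p + q ω`, and its **injectivity**
  (`ZOmega.val_injective`, from the irrationality of `√2`);
* `ZOmega.cn` — the sup norm of the four integer coordinates, with `cn (x + y) ≤ cn x + cn y`,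
  `cn (x * y) ≤ 4 cn x cn y`, and the determinant bound `cn (det M) ≤ r! · 4^r · B^r`
  (`ZOmega.cn_det_le`, Leibniz expansion; cf. Hadamard-type bounds, Mathlib `Matrix.det_le`);
* **`ZOmega.exists_cramer_combination`** — if the complex images of `u₁, …, u_r : ι → ℤ[ω]` are
  linearly independent and that of `b : ι → ℤ[ω]` lies in their span, then `D b = Σᵢ aᵢ uᵢ` for some
  `D ≠ 0`, `aᵢ` in `ℤ[ω]` with `cn D, cn aᵢ ≤ r! 4^r B^r` whenever all coordinates of the data are `≤ B`
  (a non-singular `r × r` minor from `SiegelShidlovskii.exists_submatrix_det_ne_zero`, then Mathlib's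
  `Matrix.cramer` / `Matrix.mulVec_cramer`).

## References

* S. Mehraban, M. Tahmasbi, *Quadratic lower bounds on the approximate stabilizer rank: a
  probabilistic approach*, STOC 2024, arXiv:2305.10277, proof of Thm. 1.6 (p. 6).
* S. Lang, *Algebra*, 3rd ed., Springer GTM 211, XIII §4, Prop. 4.16 (Cramer's rule over a commutative
  ring: `(adj M) M = det M · 1`).
* Mathlib: `Matrix.cramer`, `Matrix.mulVec_cramer`, `Matrix.det_apply`, `GaussianInt.toComplex`.
-/

noncomputable section

namespace Literature.Computability.QuantumComplexity

open Matrix Complex Finset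

/-! ### The ring `ℤ[ω]` as Gaussian-integer pairs -/

/-- The ring `ℤ[ω]`, `ω = e^{iπ/4}`: an element is `p + q ω` with Gaussian integers `p, q`
(`ω² = i`, so `ℤ[ω] = ℤ[i] ⊕ ℤ[i] ω`). [folklore] -/
@[ext]
structure ZOmega where
  /-- The `ℤ[i]`-coefficient of `1`. -/
  p : GaussianInt
  /-- The `ℤ[i]`-coefficient of `ω`. -/
  q : GaussianInt

namespace ZOmega

/-- The Gaussian unit `i`. [folklore] -/
def gi : GaussianInt := ⟨0, 1⟩

/-- Coordinate of a ring operation on `ℤ[ω]` (definitional). [folklore] -/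
@[simp] theorem gi_re : gi.re = 0 := rfl
/-- Coordinate of a ring operation on `ℤ[ω]` (definitional). [folklore] -/
@[simp] theorem gi_im : gi.im = 1 := rfl

/-- Componentwise structure on `ℤ[ω]` pairs. [folklore] -/
instance : Zero ZOmega := ⟨⟨0, 0⟩⟩
/-- Componentwise structure on `ℤ[ω]` pairs. [folklore] -/
instance : One ZOmega := ⟨⟨1, 0⟩⟩
/-- Componentwise structure on `ℤ[ω]` pairs. [folklore] -/
instance : Add ZOmega := ⟨fun x y => ⟨x.p + y.p, x.q + y.q⟩⟩
/-- Componentwise structure on `ℤ[ω]` pairs. [folklore] -/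
instance : Neg ZOmega := ⟨fun x => ⟨-x.p, -x.q⟩⟩
/-- `(p + qω)(p' + q'ω) = (pp' + i qq') + (pq' + qp') ω`. [folklore] -/
instance : Mul ZOmega := ⟨fun x y => ⟨x.p * y.p + gi * (x.q * y.q), x.p * y.q + x.q * y.p⟩⟩

/-- Coordinate of a ring operation on `ℤ[ω]` (definitional). [folklore] -/
@[simp] theorem zero_p : (0 : ZOmega).p = 0 := rfl
/-- Coordinate of a ring operation on `ℤ[ω]` (definitional). [folklore] -/
@[simp] theorem zero_q : (0 : ZOmega).q = 0 := rfl
/-- Coordinate of a ring operation on `ℤ[ω]` (definitional). [folklore] -/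
@[simp] theorem one_p : (1 : ZOmega).p = 1 := rfl
/-- Coordinate of a ring operation on `ℤ[ω]` (definitional). [folklore] -/
@[simp] theorem one_q : (1 : ZOmega).q = 0 := rfl
/-- Coordinate of a ring operation on `ℤ[ω]` (definitional). [folklore] -/
@[simp] theorem add_p (x y : ZOmega) : (x + y).p = x.p + y.p := rfl
/-- Coordinate of a ring operation on `ℤ[ω]` (definitional). [folklore] -/
@[simp] theorem add_q (x y : ZOmega) : (x + y).q = x.q + y.q := rfl
/-- Coordinate of a ring operation on `ℤ[ω]` (definitional). [folklore] -/
@[simp] theorem neg_p (x : ZOmega) : (-x).p = -x.p := rfl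
/-- Coordinate of a ring operation on `ℤ[ω]` (definitional). [folklore] -/
@[simp] theorem neg_q (x : ZOmega) : (-x).q = -x.q := rfl
/-- Coordinate of a ring operation on `ℤ[ω]` (definitional). [folklore] -/
@[simp] theorem mul_p (x y : ZOmega) : (x * y).p = x.p * y.p + gi * (x.q * y.q) := rfl
/-- Coordinate of a ring operation on `ℤ[ω]` (definitional). [folklore] -/
@[simp] theorem mul_q (x y : ZOmega) : (x * y).q = x.p * y.q + x.q * y.p := rfl

/-- `ℤ[ω]` is a commutative ring. [folklore] -/
instance instCommRing : CommRing ZOmega := by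
  refine
  { add := (· + ·)
    zero := 0
    neg := Neg.neg
    one := 1
    mul := (· * ·)
    sub := fun a b => a + -b
    nsmul := @nsmulRec ZOmega ⟨0⟩ ⟨(· + ·)⟩
    zsmul := @zsmulRec ZOmega ⟨0⟩ ⟨(· + ·)⟩ ⟨Neg.neg⟩ (@nsmulRec ZOmega ⟨0⟩ ⟨(· + ·)⟩)
    npow := @npowRec ZOmega ⟨1⟩ ⟨(· * ·)⟩
    add_assoc := ?_
    zero_add := ?_
    add_zero := ?_
    neg_add_cancel := ?_
    add_comm := ?_
    left_distrib := ?_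
    right_distrib := ?_
    zero_mul := ?_
    mul_zero := ?_
    mul_assoc := ?_
    one_mul := ?_
    mul_one := ?_
    mul_comm := ?_ } <;>
  intros <;>
  ext <;>
  simp <;>
  ring

/-- Coordinate of a ring operation on `ℤ[ω]` (definitional). [folklore] -/
@[simp] theorem sub_p (x y : ZOmega) : (x - y).p = x.p - y.p := by
  show (x + -y).p = _; simp [sub_eq_add_neg]
/-- Coordinate of a ring operation on `ℤ[ω]` (definitional). [folklore] -/
@[simp] theorem sub_q (x y : ZOmega) : (x - y).q = x.q - y.q := by
  show (x + -y).q = _; simp [sub_eq_add_neg]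

/-! ### Evaluation in `ℂ` and its injectivity -/

/-- The Gaussian unit evaluates to `i`. [folklore] -/
@[simp] theorem toComplex_gi : ((gi : GaussianInt) : ℂ) = I := by
  rw [gi, GaussianInt.toComplex_def']; simp

/-- The value `p + q ω ∈ ℂ` of `(p, q)`, a ring homomorphism (`ω² = i`). [folklore] -/
def val : ZOmega →+* ℂ where
  toFun x := (x.p : ℂ) + (x.q : ℂ) * omega
  map_one' := by simp
  map_mul' x y := by
    have h2 : omega ^ 2 = I := omega_pow_two
    simp only [mul_p, mul_q, GaussianInt.toComplex_add, GaussianInt.toComplex_mul, toComplex_gi]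
    linear_combination (-((x.q : ℂ) * (y.q : ℂ))) * h2
  map_zero' := by simp
  map_add' x y := by
    simp only [add_p, add_q, GaussianInt.toComplex_add]; ring

/-- Auxiliary identity for `ℤ[ω]`. [folklore] -/
theorem val_apply (x : ZOmega) : val x = (x.p : ℂ) + (x.q : ℂ) * omega := rfl

/-- `ω = √2/2 + (√2/2) i`. [folklore] -/
theorem omega_eq_sqrt_half : omega = ((Real.sqrt 2 / 2 : ℝ) : ℂ) + ((Real.sqrt 2 / 2 : ℝ) : ℂ) * I := by
  show Complex.exp _ = _
  rw [show (Real.pi : ℂ) / 4 * I = ((Real.pi / 4 : ℝ) : ℂ) * I by push_cast; ring, Complex.exp_mul_I,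
    ← Complex.ofReal_cos, ← Complex.ofReal_sin, Real.cos_pi_div_four, Real.sin_pi_div_four]

/-- `val` in real coordinates. [folklore] -/
theorem val_eq_coords (z : ZOmega) :
    val z = (((z.p.re : ℝ) + ((z.q.re : ℝ) - z.q.im) * (Real.sqrt 2 / 2) : ℝ) : ℂ) +
      (((z.p.im : ℝ) + ((z.q.re : ℝ) + z.q.im) * (Real.sqrt 2 / 2) : ℝ) : ℂ) * I := by
  rw [val_apply, GaussianInt.toComplex_def₂, GaussianInt.toComplex_def₂, omega_eq_sqrt_half]
  apply Complex.ext <;> simp <;> ring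

/-- `m √2 = n` with integers `m, n` forces `m = n = 0` (irrationality of `√2`). [folklore] -/
theorem int_mul_sqrt_two_eq_int {m n : ℤ} (h : (m : ℝ) * Real.sqrt 2 = n) : m = 0 ∧ n = 0 := by
  by_cases hm : m = 0
  · subst hm
    simp only [Int.cast_zero, zero_mul] at h
    exact ⟨rfl, by exact_mod_cast h.symm⟩
  · exfalso
    have hm' : (m : ℝ) ≠ 0 := by exact_mod_cast hm
    have : Real.sqrt 2 = ((n / m : ℚ) : ℝ) := by
      push_cast
      field_simp
      linarith [h]
    exact irrational_sqrt_two.ne_rat _ this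

/-- **`val` is injective**: `1, ω, ω², ω³` are linearly independent over `ℚ`. [folklore] -/
theorem val_injective : Function.Injective val := by
  intro x y hxy
  have h0 : val (x - y) = 0 := by rw [map_sub, hxy, sub_self]
  suffices hzero : ∀ z : ZOmega, val z = 0 → z = 0 by
    have := hzero _ h0
    rwa [sub_eq_zero] at this
  intro z hz
  rw [val_eq_coords] at hz
  have h2 := Complex.ext_iff.1 hz
  simp only [Complex.add_re, Complex.ofReal_re, Complex.mul_re, Complex.I_re, mul_zero, Complex.ofReal_im,
    Complex.I_im, mul_one, sub_self, add_zero, Complex.zero_re, Complex.add_im, Complex.mul_im, zero_add,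
    Complex.zero_im] at h2
  obtain ⟨hre, him⟩ := h2
  have e1 : ((z.q.re - z.q.im : ℤ) : ℝ) * Real.sqrt 2 = ((-2 * z.p.re : ℤ) : ℝ) := by push_cast; nlinarith [hre]
  have e2 : ((z.q.re + z.q.im : ℤ) : ℝ) * Real.sqrt 2 = ((-2 * z.p.im : ℤ) : ℝ) := by push_cast; nlinarith [him]
  obtain ⟨h1, h1'⟩ := int_mul_sqrt_two_eq_int e1
  obtain ⟨h2, h2'⟩ := int_mul_sqrt_two_eq_int e2
  ext <;> simp <;> omega

/-- `val x ≠ 0` as soon as `x ≠ 0`. [folklore] -/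
theorem val_ne_zero {x : ZOmega} (hx : x ≠ 0) : val x ≠ 0 := fun h =>
  hx (val_injective (by rw [h, map_zero]))

/-! ### Conjugates, the integer norm, and exact division by a non-zero element -/

/-- The conjugate `ω ↦ -ω = ω⁵` (fixing `i`): `p + qω ↦ p - qω`. [folklore] -/
def conj5 (x : ZOmega) : ZOmega := ⟨x.p, -x.q⟩

/-- Coordinate of a ring operation on `ℤ[ω]` (definitional). [folklore] -/
@[simp] theorem conj5_p (x : ZOmega) : (conj5 x).p = x.p := rfl
/-- Coordinate of a ring operation on `ℤ[ω]` (definitional). [folklore] -/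
@[simp] theorem conj5_q (x : ZOmega) : (conj5 x).q = -x.q := rfl

/-- `x · conj5 x = p² - i q²` lies in `ℤ[i]` (its `ω`-coordinate vanishes). [folklore] -/
theorem mul_conj5 (x : ZOmega) : x * conj5 x = ⟨x.p * x.p - gi * (x.q * x.q), 0⟩ := by
  ext <;> simp <;> ring

/-- Complex conjugation on the `ℤ[i]`-part: `(p, 0) ↦ (p̄, 0)`. [folklore] -/
def starP (x : ZOmega) : ZOmega := ⟨star x.p, 0⟩

/-- Coordinate of a ring operation on `ℤ[ω]` (definitional). [folklore] -/
@[simp] theorem starP_p (x : ZOmega) : (starP x).p = star x.p := rfl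
/-- Coordinate of a ring operation on `ℤ[ω]` (definitional). [folklore] -/
@[simp] theorem starP_q (x : ZOmega) : (starP x).q = 0 := rfl

/-- The integer norm `N(x) = |p² - i q²|²` (the field norm of `ℚ(ω)/ℚ` on `ℤ[ω]`). [folklore] -/
def inorm (x : ZOmega) : ℤ := (x.p * x.p - gi * (x.q * x.q)).norm

/-- **Norm identity**: `x · conj5 x · starP (x · conj5 x) = (N(x), 0, 0, 0)`. [folklore] -/
theorem mul_conj5_mul_starP (x : ZOmega) :
    x * conj5 x * starP (x * conj5 x) = ⟨⟨inorm x, 0⟩, 0⟩ := by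
  rw [mul_conj5]
  ext <;> simp [starP, inorm, Zsqrtd.norm_def, Zsqrtd.re_mul, Zsqrtd.im_mul] <;> ring

/-- `conj5` is involutive, hence detects `0`. [folklore] -/
theorem conj5_eq_zero_iff {x : ZOmega} : conj5 x = 0 ↔ x = 0 := by
  constructor
  · intro h
    have hp := congrArg ZOmega.p h
    have hq := congrArg ZOmega.q h
    simp only [conj5_p, conj5_q, zero_p, zero_q, neg_eq_zero] at hp hq
    ext1 <;> assumption
  · rintro rfl; rfl

/-- **The norm of a non-zero element is non-zero.** [folklore] -/
theorem inorm_ne_zero {x : ZOmega} (hx : x ≠ 0) : inorm x ≠ 0 := by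
  intro h
  have hy : x.p * x.p - gi * (x.q * x.q) = 0 := (Zsqrtd.norm_eq_zero_iff (by norm_num) _).1 h
  have hval : val (x * conj5 x) = 0 := by
    rw [mul_conj5, val_apply]
    simp [hy]
  rw [map_mul, mul_eq_zero] at hval
  rcases hval with h0 | h0
  · exact hx (val_injective (by rw [h0, map_zero]))
  · exact hx (conj5_eq_zero_iff.1 (val_injective (by rw [h0, map_zero])))

/-- Integers in coordinates: `k = (k, 0, 0, 0)`. [folklore] -/
theorem intCast_eq (k : ℤ) : ((k : ZOmega)) = ⟨⟨k, 0⟩, 0⟩ := by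
  induction k using Int.induction_on with
  | zero => rfl
  | succ n ih => push_cast at ih ⊢; rw [ih]; ext <;> simp
  | pred n ih => push_cast at ih ⊢; rw [ih]; ext <;> simp

/-- **Exact division.** If `num = k · D` in `ℤ[ω]` for an integer `k`, then `k · N(D)` is the first
coordinate of `num · conj5 D · starP (D · conj5 D)`; with `N(D) ≠ 0` for `D ≠ 0` this recovers `k`
from `num` and `D` by ring operations and one exact integer division. [folklore] -/
theorem intCast_mul_eq_coord {num D : ZOmega} {k : ℤ} (h : num = (k : ZOmega) * D) :
    (num * conj5 D * starP (D * conj5 D)).p.re = k * inorm D := by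
  have e : num * conj5 D * starP (D * conj5 D) = (k : ZOmega) * (D * conj5 D * starP (D * conj5 D)) := by
    rw [h]; ring
  rw [e, mul_conj5_mul_starP, intCast_eq]
  simp [Zsqrtd.re_mul]

/-! ### The coordinate sup-norm -/

/-- The sup norm of the four integer coordinates of `p + q ω`. [folklore] -/
def cn (x : ZOmega) : ℕ := max (max x.p.re.natAbs x.p.im.natAbs) (max x.q.re.natAbs x.q.im.natAbs)

/-- Coordinate-norm bookkeeping. [folklore] -/
theorem pre_le_cn (x : ZOmega) : x.p.re.natAbs ≤ cn x := (le_max_left _ _).trans (le_max_left _ _)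
/-- Coordinate-norm bookkeeping. [folklore] -/
theorem pim_le_cn (x : ZOmega) : x.p.im.natAbs ≤ cn x := (le_max_right _ _).trans (le_max_left _ _)
/-- Coordinate-norm bookkeeping. [folklore] -/
theorem qre_le_cn (x : ZOmega) : x.q.re.natAbs ≤ cn x := (le_max_left _ _).trans (le_max_right _ _)
/-- Coordinate-norm bookkeeping. [folklore] -/
theorem qim_le_cn (x : ZOmega) : x.q.im.natAbs ≤ cn x := (le_max_right _ _).trans (le_max_right _ _)

/-- Coordinate-norm bookkeeping. [folklore] -/
theorem cn_le_iff {x : ZOmega} {B : ℕ} :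
    cn x ≤ B ↔ x.p.re.natAbs ≤ B ∧ x.p.im.natAbs ≤ B ∧ x.q.re.natAbs ≤ B ∧ x.q.im.natAbs ≤ B := by
  simp only [cn, max_le_iff, and_assoc]

/-- Coordinate-norm bookkeeping. [folklore] -/
@[simp] theorem cn_zero : cn 0 = 0 := rfl
/-- Coordinate-norm bookkeeping. [folklore] -/
@[simp] theorem cn_one : cn 1 = 1 := rfl

/-- Coordinate-norm bookkeeping. [folklore] -/
@[simp] theorem cn_neg (x : ZOmega) : cn (-x) = cn x := by
  simp [cn, Int.natAbs_neg]

/-- Subadditivity. [folklore] -/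
theorem cn_add_le (x y : ZOmega) : cn (x + y) ≤ cn x + cn y := by
  rw [cn_le_iff]
  refine ⟨?_, ?_, ?_, ?_⟩
  · exact (Int.natAbs_add_le _ _).trans (add_le_add (pre_le_cn x) (pre_le_cn y))
  · exact (Int.natAbs_add_le _ _).trans (add_le_add (pim_le_cn x) (pim_le_cn y))
  · exact (Int.natAbs_add_le _ _).trans (add_le_add (qre_le_cn x) (qre_le_cn y))
  · exact (Int.natAbs_add_le _ _).trans (add_le_add (qim_le_cn x) (qim_le_cn y))

/-- A sum of four products of integers bounded by `X` resp. `Y` is bounded by `4 X Y`. [folklore] -/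
private theorem natAbs_four_le {e a₁ b₁ a₂ b₂ a₃ b₃ a₄ b₄ : ℤ} {X Y : ℕ}
    (he : |e| ≤ |a₁ * b₁| + |a₂ * b₂| + |a₃ * b₃| + |a₄ * b₄|)
    (h₁ : a₁.natAbs ≤ X) (h₂ : a₂.natAbs ≤ X) (h₃ : a₃.natAbs ≤ X) (h₄ : a₄.natAbs ≤ X)
    (k₁ : b₁.natAbs ≤ Y) (k₂ : b₂.natAbs ≤ Y) (k₃ : b₃.natAbs ≤ Y) (k₄ : b₄.natAbs ≤ Y) :
    e.natAbs ≤ 4 * (X * Y) := by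
  have hp : ∀ {a b : ℤ}, a.natAbs ≤ X → b.natAbs ≤ Y → |a * b| ≤ (X : ℤ) * Y := by
    intro a b ha hb
    rw [abs_mul, ← Int.natCast_natAbs, ← Int.natCast_natAbs]
    exact_mod_cast Nat.mul_le_mul ha hb
  have : (e.natAbs : ℤ) ≤ 4 * ((X : ℤ) * Y) := by
    rw [Int.natCast_natAbs]
    linarith [hp h₁ k₁, hp h₂ k₂, hp h₃ k₃, hp h₄ k₄]
  exact_mod_cast this

/-- Submultiplicativity up to the factor `4`. [folklore] -/
theorem cn_mul_le (x y : ZOmega) : cn (x * y) ≤ 4 * (cn x * cn y) := by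
  rw [cn_le_iff]
  have habs : ∀ u v w z : ℤ, |u + v + w + z| ≤ |u| + |v| + |w| + |z| := fun u v w z => by
    have h₁ := abs_add_le (u + v + w) z
    have h₂ := abs_add_le (u + v) w
    have h₃ := abs_add_le u v
    linarith
  refine ⟨?_, ?_, ?_, ?_⟩
  · -- `(xy).p.re = p.re p'.re - p.im p'.im - (q.re q'.im + q.im q'.re)`
    refine natAbs_four_le (a₁ := x.p.re) (b₁ := y.p.re) (a₂ := x.p.im) (b₂ := y.p.im)
      (a₃ := x.q.re) (b₃ := y.q.im) (a₄ := x.q.im) (b₄ := y.q.re) ?_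
      (pre_le_cn x) (pim_le_cn x) (qre_le_cn x) (qim_le_cn x)
      (pre_le_cn y) (pim_le_cn y) (qim_le_cn y) (qre_le_cn y)
    have e : (x * y).p.re = x.p.re * y.p.re + -(x.p.im * y.p.im) + -(x.q.re * y.q.im) + -(x.q.im * y.q.re) := by
      simp [Zsqrtd.re_mul, Zsqrtd.im_mul]; ring
    rw [e]
    refine (habs _ _ _ _).trans ?_
    simp only [abs_neg]; rfl
  · refine natAbs_four_le (a₁ := x.p.re) (b₁ := y.p.im) (a₂ := x.p.im) (b₂ := y.p.re)
      (a₃ := x.q.re) (b₃ := y.q.re) (a₄ := x.q.im) (b₄ := y.q.im) ?_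
      (pre_le_cn x) (pim_le_cn x) (qre_le_cn x) (qim_le_cn x)
      (pim_le_cn y) (pre_le_cn y) (qre_le_cn y) (qim_le_cn y)
    have e : (x * y).p.im = x.p.re * y.p.im + x.p.im * y.p.re + x.q.re * y.q.re + -(x.q.im * y.q.im) := by
      simp [Zsqrtd.re_mul, Zsqrtd.im_mul]; ring
    rw [e]
    refine (habs _ _ _ _).trans ?_
    simp only [abs_neg]; rfl
  · refine natAbs_four_le (a₁ := x.p.re) (b₁ := y.q.re) (a₂ := x.p.im) (b₂ := y.q.im)
      (a₃ := x.q.re) (b₃ := y.p.re) (a₄ := x.q.im) (b₄ := y.p.im) ?_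
      (pre_le_cn x) (pim_le_cn x) (qre_le_cn x) (qim_le_cn x)
      (qre_le_cn y) (qim_le_cn y) (pre_le_cn y) (pim_le_cn y)
    have e : (x * y).q.re = x.p.re * y.q.re + -(x.p.im * y.q.im) + x.q.re * y.p.re + -(x.q.im * y.p.im) := by
      simp [Zsqrtd.re_mul]; ring
    rw [e]
    refine (habs _ _ _ _).trans ?_
    simp only [abs_neg]; rfl
  · refine natAbs_four_le (a₁ := x.p.re) (b₁ := y.q.im) (a₂ := x.p.im) (b₂ := y.q.re)
      (a₃ := x.q.re) (b₃ := y.p.im) (a₄ := x.q.im) (b₄ := y.p.re) ?_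
      (pre_le_cn x) (pim_le_cn x) (qre_le_cn x) (qim_le_cn x)
      (qim_le_cn y) (qre_le_cn y) (pim_le_cn y) (pre_le_cn y)
    have e : (x * y).q.im = x.p.re * y.q.im + x.p.im * y.q.re + x.q.re * y.p.im + x.q.im * y.p.re := by
      simp [Zsqrtd.im_mul]; ring
    rw [e]
    exact (habs _ _ _ _).trans le_rfl

/-- A unit of `ℤ` acts by `±1`, preserving the coordinate norm. [folklore] -/
theorem cn_units_smul (u : ℤˣ) (x : ZOmega) : cn (u • x) = cn x := by
  rcases Int.units_eq_one_or u with rfl | rfl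
  · rw [one_smul]
  · rw [Units.smul_def, Units.val_neg, Units.val_one, neg_one_zsmul, cn_neg]

/-- The norm of a sum. [folklore] -/
theorem cn_sum_le {α : Type*} (s : Finset α) (f : α → ZOmega) :
    cn (∑ i ∈ s, f i) ≤ ∑ i ∈ s, cn (f i) := by
  classical
  induction s using Finset.induction_on with
  | empty => simp
  | insert a s ha ih =>
    rw [Finset.sum_insert ha, Finset.sum_insert ha]
    exact (cn_add_le _ _).trans (Nat.add_le_add_left ih _)

/-- The norm of a product of `k` factors is at most `4^k` times the product of the norms. [folklore] -/
theorem cn_prod_le {α : Type*} (s : Finset α) (f : α → ZOmega) :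
    cn (∏ i ∈ s, f i) ≤ 4 ^ s.card * ∏ i ∈ s, cn (f i) := by
  classical
  induction s using Finset.induction_on with
  | empty => simp
  | insert a s ha ih =>
    rw [Finset.prod_insert ha, Finset.prod_insert ha, Finset.card_insert_of_notMem ha, pow_succ]
    calc cn (f a * ∏ i ∈ s, f i) ≤ 4 * (cn (f a) * cn (∏ i ∈ s, f i)) := cn_mul_le _ _
      _ ≤ 4 * (cn (f a) * (4 ^ s.card * ∏ i ∈ s, cn (f i))) :=
          Nat.mul_le_mul_left _ (Nat.mul_le_mul_left _ ih)
      _ = 4 ^ s.card * 4 * (cn (f a) * ∏ i ∈ s, cn (f i)) := by ring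

/-- **Determinant bound.** If all entries of an `r × r` matrix over `ℤ[ω]` have coordinates bounded
by `B`, then the coordinates of its determinant are bounded by `r! · 4^r · B^r` (Leibniz expansion,
`Matrix.det_apply`). [folklore] -/
theorem cn_det_le {n : Type*} [Fintype n] [DecidableEq n] (M : Matrix n n ZOmega) {B : ℕ}
    (hB : ∀ i j, cn (M i j) ≤ B) :
    cn M.det ≤ (Fintype.card n).factorial * (4 ^ Fintype.card n * B ^ Fintype.card n) := by
  rw [Matrix.det_apply]
  refine (cn_sum_le _ _).trans ?_
  have hterm : ∀ σ : Equiv.Perm n, cn (Equiv.Perm.sign σ • ∏ i, M (σ i) i) ≤ 4 ^ Fintype.card n * B ^ Fintype.card n := by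
    intro σ
    rw [cn_units_smul]
    refine (cn_prod_le _ _).trans ?_
    rw [Finset.card_univ]
    refine Nat.mul_le_mul_left _ ?_
    calc ∏ i, cn (M (σ i) i) ≤ ∏ _i : n, B := Finset.prod_le_prod (fun _ _ => Nat.zero_le _) fun i _ => hB _ _
      _ = B ^ Fintype.card n := by rw [Finset.prod_const, Finset.card_univ]
  calc ∑ σ : Equiv.Perm n, cn (Equiv.Perm.sign σ • ∏ i, M (σ i) i)
      ≤ ∑ _σ : Equiv.Perm n, 4 ^ Fintype.card n * B ^ Fintype.card n := Finset.sum_le_sum fun σ _ => hterm σ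
    _ = (Fintype.card n).factorial * (4 ^ Fintype.card n * B ^ Fintype.card n) := by
      rw [Finset.sum_const, Finset.card_univ, Fintype.card_perm, smul_eq_mul]

/-! ### Cramer's rule with a non-singular minor -/

/-- **Integral Cramer decomposition.** Let `u₁, …, u_r, b : ι → ℤ[ω]`. If the complex vectors
`val ∘ uᵢ` are linearly independent and `val ∘ b` lies in their complex span, then there are
`D, a₁, …, a_r ∈ ℤ[ω]` with `val D ≠ 0` and `Σᵢ aᵢ uᵢ = D b`; moreover if all coordinates of all
`uᵢ x` and `b x` are at most `B`, then `cn D, cn aᵢ ≤ r! · 4^r · B^r`. (`D` is a non-vanishing `r × r`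
minor of the matrix of the `uᵢ` — it exists because the columns are independent — and the `aᵢ` are
the Cramer numerators; the identity holds on the selected rows by `Matrix.mulVec_cramer` and on all
rows because the complex solution is unique.) This is the exact form of "polynomial bits of advice
suffice for the coefficients `cᵢ = (G⁻¹β)ᵢ`" in the proof of Mehraban–Tahmasbi 2024, Thm. 1.6.
[cite: MehrabanTahmasbi2024, proof of Theorem 1.6 (arXiv p. 6)] -/
theorem exists_cramer_combination {ι : Type*} [Fintype ι] {r : ℕ} (u : Fin r → ι → ZOmega)
    (b : ι → ZOmega) (hli : LinearIndependent ℂ fun i => (val ∘ u i : ι → ℂ))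
    (hb : (val ∘ b : ι → ℂ) ∈ Submodule.span ℂ (Set.range fun i => (val ∘ u i : ι → ℂ))) :
    ∃ (D : ZOmega) (a : Fin r → ZOmega), val D ≠ 0 ∧ (∀ x, ∑ i, a i * u i x = D * b x) ∧
      ∀ B : ℕ, (∀ i x, cn (u i x) ≤ B) → (∀ x, cn (b x) ≤ B) →
        cn D ≤ r.factorial * (4 ^ r * B ^ r) ∧ ∀ i, cn (a i) ≤ r.factorial * (4 ^ r * B ^ r) := by
  classical
  -- the complex solution
  obtain ⟨c, hc⟩ := Submodule.mem_span_range_iff_exists_fun ℂ |>.1 hb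
  -- reindex the rows by `Fin n`
  set n := Fintype.card ι
  set e : ι ≃ Fin n := Fintype.equivFin ι
  set Q : Matrix (Fin n) (Fin r) ℂ := fun x i => val (u i (e.symm x)) with hQ
  have hQli : LinearIndependent ℂ (fun i : Fin r => fun x : Fin n => Q x i) := by
    have h := hli.map' (LinearEquiv.funCongrLeft ℂ ℂ e.symm).toLinearMap (LinearEquiv.ker _)
    exact h
  obtain ⟨I, hI, hdet⟩ := Literature.Barriers.Schanuel.SiegelShidlovskii.exists_submatrix_det_ne_zero Q hQli
  -- the integral minor and the Cramer numerators
  set M : Matrix (Fin r) (Fin r) ZOmega := fun j i => u i (e.symm (I j)) with hM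
  have hMmap : M.map val = Q.submatrix I id := by
    ext j i; rfl
  set D : ZOmega := M.det with hD
  have hvalD : val D = (Q.submatrix I id).det := by
    rw [hD, RingHom.map_det, RingHom.mapMatrix_apply, hMmap]
  set bI : Fin r → ZOmega := fun j => b (e.symm (I j)) with hbI
  set a : Fin r → ZOmega := M.cramer bI with ha
  have hcr : M *ᵥ a = D • bI := by rw [ha, Matrix.mulVec_cramer]
  -- the complex images of the `aᵢ` are `val D · cᵢ`
  have hQc : (Q.submatrix I id) *ᵥ c = fun j => val (bI j) := by
    funext j
    have := congrFun hc (e.symm (I j))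
    simp only [Finset.sum_apply, Pi.smul_apply, Function.comp_apply, smul_eq_mul] at this
    rw [← this, Matrix.mulVec, dotProduct]
    refine Finset.sum_congr rfl fun i _ => ?_
    simp [hQ, Matrix.submatrix_apply, mul_comm]
  have hQa : (Q.submatrix I id) *ᵥ (val ∘ a) = fun j => val D * val (bI j) := by
    funext j
    have := RingHom.map_mulVec val M a j
    rw [hcr, hMmap] at this
    rw [← this]
    simp [Pi.smul_apply, smul_eq_mul]
  have hva : (val ∘ a) = fun i => val D * c i := by
    have hzero : (Q.submatrix I id) *ᵥ ((val ∘ a) - fun i => val D * c i) = 0 := by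
      rw [Matrix.mulVec_sub, hQa]
      have : (Q.submatrix I id) *ᵥ (fun i => val D * c i) = fun j => val D * val (bI j) := by
        have e2 : (fun i => val D * c i) = val D • c := by funext i; simp [smul_eq_mul]
        rw [e2, Matrix.mulVec_smul, hQc]
        funext j; simp [smul_eq_mul]
      rw [this, sub_self]
    have := Matrix.eq_zero_of_mulVec_eq_zero hdet hzero
    exact sub_eq_zero.1 this
  refine ⟨D, a, by rwa [hvalD], fun x => ?_, fun B huB hbB => ⟨?_, fun i => ?_⟩⟩
  · -- the identity on every row, by injectivity of `val`
    apply val_injective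
    rw [map_sum, map_mul]
    have hcx := congrFun hc x
    simp only [Finset.sum_apply, Pi.smul_apply, Function.comp_apply, smul_eq_mul] at hcx
    rw [← hcx, Finset.mul_sum]
    refine Finset.sum_congr rfl fun i _ => ?_
    rw [map_mul, show val (a i) = val D * c i from congrFun hva i]
    ring
  · -- bound for `D`
    have h := cn_det_le M (B := B) fun j i => huB i _
    simpa [Fintype.card_fin] using h
  · -- bound for `aᵢ = det (M with column i replaced by bI)`
    rw [ha, Matrix.cramer_apply]
    have h := cn_det_le (M.updateCol i bI) (B := B) fun j i' => by
      rw [Matrix.updateCol_apply]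
      split_ifs
      · exact hbB _
      · exact huB _ _
    simpa [Fintype.card_fin] using h

end ZOmega

end Literature.Computability.QuantumComplexity
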